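import Summits.CriticalPhenomena.PercolationContinuityZ3.Theorems.PercNearOneGluingNoHeavyLowerTailSahiCTCRtForm
import Summits.CriticalPhenomena.PercolationContinuityZ3.Theorems.PercNearOneGluingNoHeavyLowerTailSahiCTCLadderSqfreeT
import HarnessLib

/-!
# `NoHeavyLowerTail` (crux stmt-CriticalPhenomena-4575), P3 lane: the SIGNED FORM of `R_3` —
# `R_3 = Θ₂·(Π·Y − X·Z) − Π·(N₂·Y₂ − X₂ᵒ·Z₂ᵒ)` ("Θ₂ ⊗ Harris of all sets minus Π ⊗ Harris of the small sets") and its squarefree coefficients: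
# Kleitman surpluses of the top cubes, plus crossing small pairs, minus nested small pairs

Support file (seat `prim-l12-p3`, gen 46; `--supports stmt-CriticalPhenomena-4575`).  Memo
`run/shared/lean/prim/prim-l12/FROM-prim-l12-p3-g46-SIGNED-FORM-AND-EX-REFUTED.md` §2.

For up-sets `𝒳, 𝒵 ⊆ 2^α` split the SMALL sets (size `≤ 2`) into four classes: `N₂` = in neither family (`smallN`, contains `∅` when `∅ ∉ 𝒳 ∪ 𝒵`),
`X₂ᵒ` = in `𝒳` only (`smallXo`), `Z₂ᵒ` = in `𝒵` only (`smallZo`), `Y₂` = in both (`smallY`).  Since the small-world form is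
`N_3 = X_{≤2}·Z_{≤2} − Θ₂·Y_{≤2}` (`…SahiCTCRtForm`) and `X_{≤2} = X₂ᵒ + Y₂`, `Z_{≤2} = Z₂ᵒ + Y₂`, `Θ₂ = N₂ + X₂ᵒ + Z₂ᵒ + Y₂`:
* `Rt_three_eq_signed` : **`R_3(𝒳,𝒵) = Θ₂·(Π·GF(𝒳∩𝒵) − GF(𝒳)GF(𝒵)) + Π·(GF(X₂ᵒ)·GF(Z₂ᵒ) − GF(N₂)·GF(Y₂))`** — the first block is `Θ₂` times the
  Harris form (coefficients = Kleitman surpluses `kap` of sub-cubes, all `≥ 0`), the second is `Π` times the SIGNED Harris form of the small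
  sets ("crossing small pairs minus nested small pairs"); this is the whole content of the level-3 threshold correlation `R_3 ∈ ℕ[s]`;
* `coeff_ind_gf_mul_gf_eq_card` : at a squarefree monomial `s^T`, `GF(A)·GF(B)` counts the ordered pairs `(P,Q) ∈ A × B` partitioning `T`;
* `coeff_ind_Theta_harris_eq_sum_kap` : `[s^V] Θ₂·H = Σ_{U ⊆ V, #U ≤ 2} κ(∅, V∖U)` (Kleitman surpluses of the top three layers of sub-cubes);
* **`coeff_ind_Rt_three_eq`** : `[s^V] R_3 = Σ_{U ⊆ V, #U ≤ 2} κ(∅, V∖U) + Σ_{S ⊆ V} (#crossing small pairs partitioning V∖S − #nested small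
  pairs partitioning V∖S)` — the squarefree row of `R_3 ∈ ℕ[s]` as "top-cube surpluses + crossing small pairs ≥ nested small pairs" (memo §2;
  gen 46 proves it whenever a common loop lies in `V`, memo §3).
Nothing is asserted about the crux.
-/

noncomputable section

open scoped Classical

namespace Summit.CriticalPhenomena.PercolationContinuityZ3.Theorems.SahiCTCForms

open Finset MvPolynomial SahiCTCGenFun

variable {α : Type*} [DecidableEq α] [Fintype α]

/-! ### The four classes of small sets -/

section Classes
variable (F G : Finset (Finset α))

/-- `N₂`: the sets of size `≤ 2` in neither family (common small non-members; contains `∅` unless a family is trivial). [this work] -/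
def smallN : Finset (Finset α) := (bySize (· < 3)).filter fun S => S ∉ F ∧ S ∉ G

/-- `X₂ᵒ`: the sets of size `≤ 2` in `𝒳` but not in `𝒵`. [this work] -/
def smallXo : Finset (Finset α) := (bySize (· < 3)).filter fun S => S ∈ F ∧ S ∉ G

/-- `Z₂ᵒ`: the sets of size `≤ 2` in `𝒵` but not in `𝒳`. [this work] -/
def smallZo : Finset (Finset α) := (bySize (· < 3)).filter fun S => S ∉ F ∧ S ∈ G

/-- `Y₂`: the sets of size `≤ 2` in both families (common small members). [this work] -/
def smallY : Finset (Finset α) := (bySize (· < 3)).filter fun S => S ∈ F ∧ S ∈ G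

/-- `GF(X_{<3}) = GF(X₂ᵒ) + GF(Y₂)`. [this work] -/
theorem gf_below_three_left : gf (below 3 F) = gf (smallXo F G) + gf (smallY F G) := by
  rw [← gf_union]
  · congr 1; ext S
    simp only [below, smallXo, smallY, mem_filter, mem_union, bySize, mem_powerset, subset_univ, true_and]
    tauto
  · exact disjoint_left.2 fun S h1 h2 => (mem_filter.1 h1).2.2 (mem_filter.1 h2).2.2

/-- `GF(Z_{<3}) = GF(Z₂ᵒ) + GF(Y₂)`. [this work] -/
theorem gf_below_three_right : gf (below 3 G) = gf (smallZo F G) + gf (smallY F G) := by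
  rw [← gf_union]
  · congr 1; ext S
    simp only [below, smallZo, smallY, mem_filter, mem_union, bySize, mem_powerset, subset_univ, true_and]
    tauto
  · exact disjoint_left.2 fun S h1 h2 => (mem_filter.1 h1).2.1 (mem_filter.1 h2).2.1

/-- `GF((X∩Z)_{<3}) = GF(Y₂)`. [this work] -/
theorem gf_below_three_inter : gf (below 3 (F ∩ G)) = gf (smallY F G) := by
  congr 1; ext S
  simp only [below, smallY, mem_filter, mem_inter, bySize, mem_powerset, subset_univ, true_and]
  tauto

/-- `Θ₂ = GF(N₂) + GF(X₂ᵒ) + GF(Z₂ᵒ) + GF(Y₂)`. [this work] -/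
theorem gf_bySize_lt_three_eq :
    gf (bySize (· < 3) : Finset (Finset α)) = gf (smallN F G) + gf (smallXo F G) + gf (smallZo F G) + gf (smallY F G) := by
  have hd1 : Disjoint (smallN F G) (smallXo F G) :=
    disjoint_left.2 fun S h1 h2 => (mem_filter.1 h1).2.1 (mem_filter.1 h2).2.1
  have hd2 : Disjoint (smallN F G ∪ smallXo F G) (smallZo F G) := by
    refine disjoint_left.2 fun S h1 h2 => ?_
    rcases mem_union.1 h1 with h | h
    · exact (mem_filter.1 h).2.2 (mem_filter.1 h2).2.2
    · exact (mem_filter.1 h2).2.1 (mem_filter.1 h).2.1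
  have hd3 : Disjoint (smallN F G ∪ smallXo F G ∪ smallZo F G) (smallY F G) := by
    refine disjoint_left.2 fun S h1 h2 => ?_
    rcases mem_union.1 h1 with h | h
    · rcases mem_union.1 h with h' | h'
      · exact (mem_filter.1 h').2.1 (mem_filter.1 h2).2.1
      · exact (mem_filter.1 h').2.2 (mem_filter.1 h2).2.2
    · exact (mem_filter.1 h).2.1 (mem_filter.1 h2).2.1
  rw [← gf_union hd1, ← gf_union hd2, ← gf_union hd3]
  congr 1; ext S
  simp only [smallN, smallXo, smallZo, smallY, mem_union, mem_filter]
  tauto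

end Classes

/-! ### The signed form -/

/-- **THE SIGNED FORM OF `R_3`**: `R_3(𝒳,𝒵) = Θ₂·(Π·GF(𝒳∩𝒵) − GF(𝒳)·GF(𝒵)) + Π·(GF(X₂ᵒ)·GF(Z₂ᵒ) − GF(N₂)·GF(Y₂))` — `Θ₂` times the Harris
form of the pair minus `Π` times the Harris form of its small sets (memo g46 §2, identity (P1)). [this work] -/
theorem Rt_three_eq_signed (F G : Finset (Finset α)) :
    Rt 3 F G = gf (bySize (· < 3)) * (PiP * gf (F ∩ G) - gf F * gf G)
      + PiP * (gf (smallXo F G) * gf (smallZo F G) - gf (smallN F G) * gf (smallY F G)) := by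
  rw [Rt_eq_harris_add_Nt]
  unfold Nt
  rw [gf_below_three_left F G, gf_below_three_right F G, gf_below_three_inter F G, gf_bySize_lt_three_eq F G]
  ring

/-! ### Squarefree coefficients -/

omit [Fintype α] in
/-- `1_P + 1_Q = 1_T` iff `P, Q` are disjoint with union `T`. [this work] -/
theorem ind_add_ind_eq_ind_iff (P Q T : Finset α) : ind P + ind Q = ind T ↔ Disjoint P Q ∧ P ∪ Q = T := by
  rw [ind_add_ind_eq_iff, dbl_ind, ind_support_eq, disjoint_iff_inter_eq_empty]
  exact ⟨fun h => ⟨h.2.1, h.2.2⟩, fun h => ⟨ind_apply_le_two T, h.1, h.2⟩⟩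

omit [Fintype α] in
/-- **Squarefree coefficient of a product of two generating functions**: the number of ordered pairs `(P,Q) ∈ A × B` partitioning `T`. [this work] -/
theorem coeff_ind_gf_mul_gf_eq_card (A B : Finset (Finset α)) (T : Finset α) :
    (gf A * gf B).coeff (ind T) = #((A ×ˢ B).filter fun PQ => Disjoint PQ.1 PQ.2 ∧ PQ.1 ∪ PQ.2 = T) := by
  rw [coeff_gf_mul_gf]
  congr 2; ext PQ
  simp only [mem_filter, ind_add_ind_eq_ind_iff]

/-- **`[s^V] Θ₂·(Π·Y − X·Z) = Σ_{U ⊆ V, #U ≤ 2} κ(∅, V∖U)`**: the squarefree coefficients of the first block of the signed form are the Kleitman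
surpluses of the pair on the sub-cubes of co-dimension `≤ 2` of `2^V`. [this work] -/
theorem coeff_ind_Theta_harris_eq_sum_kap (F G : Finset (Finset α)) (V : Finset α) :
    (gf (bySize (· < 3) : Finset (Finset α)) * (PiP * gf (F ∩ G) - gf F * gf G)).coeff (ind V) =
      ∑ U ∈ V.powerset.filter (fun U => #U ≤ 2), kap F G ∅ (V \ U) := by
  rw [coeff_gf_mul]
  have hidx : ((bySize (· < 3) : Finset (Finset α)).filter fun U => ind U ≤ ind V) = V.powerset.filter fun U => #U ≤ 2 := by
    ext U
    simp only [bySize, mem_filter, mem_powerset, subset_univ, true_and, ind_le_ind_iff]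
    constructor
    · rintro ⟨h1, h2⟩; exact ⟨h2, by omega⟩
    · rintro ⟨h1, h2⟩; exact ⟨by omega, h1⟩
  rw [hidx]
  refine sum_congr rfl fun U hU => ?_
  rw [ind_sub_ind (mem_powerset.1 (mem_filter.1 hU).1), coeff_ind_harris_eq_kap]

/-- The number of ordered pairs `(P, Q) ∈ A × B` partitioning `T`. [this work] -/
def pairsAt (A B : Finset (Finset α)) (T : Finset α) : ℕ := #((A ×ˢ B).filter fun PQ => Disjoint PQ.1 PQ.2 ∧ PQ.1 ∪ PQ.2 = T)

/-- **`[s^V] Π·(GF(A)·GF(B)) = Σ_{S ⊆ V} #{(P,Q) ∈ A × B partitioning V∖S}`** (the number of disjoint pairs of `A × B` inside `V`). [this work] -/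
theorem coeff_ind_PiP_mul_gf_mul_gf (A B : Finset (Finset α)) (V : Finset α) :
    ((PiP : MvPolynomial α ℤ) * (gf A * gf B)).coeff (ind V) = ∑ S ∈ V.powerset, (pairsAt A B (V \ S) : ℤ) := by
  unfold PiP
  rw [coeff_gf_mul]
  have hidx : ((univ.powerset : Finset (Finset α)).filter fun S => ind S ≤ ind V) = V.powerset := by
    ext S; simp only [mem_filter, mem_powerset, subset_univ, true_and, ind_le_ind_iff]
  rw [hidx]
  refine sum_congr rfl fun S hS => ?_
  rw [ind_sub_ind (mem_powerset.1 hS), coeff_ind_gf_mul_gf_eq_card]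
  rfl

/-- **THE SQUAREFREE ROW OF `R_3` IN SIGNED FORM**: for every finset `V`,
`[s^V] R_3(𝒳,𝒵) = Σ_{U ⊆ V, #U ≤ 2} κ(∅, V∖U) + Σ_{S ⊆ V} (#crossing small pairs − #nested small pairs partitioning V∖S)`,
where a crossing small pair is `(P,Q) ∈ X₂ᵒ × Z₂ᵒ` and a nested small pair is `(N,Y) ∈ N₂ × Y₂` (memo g46 §2, (SQF)).  For up-sets every `κ`
is `≥ 0` (`kap_nonneg`), so the squarefree row of `R_3 ∈ ℕ[s]` says: Kleitman surpluses of the top cubes plus crossing small pairs dominate the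
nested small pairs. [this work] -/
theorem coeff_ind_Rt_three_eq (F G : Finset (Finset α)) (V : Finset α) :
    (Rt 3 F G).coeff (ind V) = (∑ U ∈ V.powerset.filter (fun U => #U ≤ 2), kap F G ∅ (V \ U))
      + ∑ S ∈ V.powerset, ((pairsAt (smallXo F G) (smallZo F G) (V \ S) : ℤ) - pairsAt (smallN F G) (smallY F G) (V \ S)) := by
  rw [Rt_three_eq_signed, coeff_add, coeff_ind_Theta_harris_eq_sum_kap, mul_sub, coeff_sub, coeff_ind_PiP_mul_gf_mul_gf,
    coeff_ind_PiP_mul_gf_mul_gf, ← sum_sub_distrib]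

/-- **Sufficient condition for the squarefree row**: if the Kleitman surpluses of the top cubes of `2^V` plus the crossing small pairs inside
`V` dominate the nested small pairs inside `V`, then `[s^V] R_3(𝒳,𝒵) ≥ 0`. [this work] -/
theorem coeff_ind_Rt_three_nonneg_of_le (F G : Finset (Finset α)) (V : Finset α)
    (h : ∑ S ∈ V.powerset, (pairsAt (smallN F G) (smallY F G) (V \ S) : ℤ) ≤
      (∑ U ∈ V.powerset.filter (fun U => #U ≤ 2), kap F G ∅ (V \ U)) + ∑ S ∈ V.powerset, (pairsAt (smallXo F G) (smallZo F G) (V \ S) : ℤ)) :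
    0 ≤ (Rt 3 F G).coeff (ind V) := by
  rw [coeff_ind_Rt_three_eq, sum_sub_distrib]
  linarith

end Summit.CriticalPhenomena.PercolationContinuityZ3.Theorems.SahiCTCForms
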